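import Summits.ResolutionOfSingularities.ResolutionOfSingularities.Theorems.EquisingularLiftEquisingularLiftNatSpecimenQuarticTangentLine
import HarnessLib

/-!
# [OURS · L1 W4.5(b)] T-ISO-1 algebra layer, VI: `√(ȳ₁) = (ȳ₁, ȳ₂)` in `k[y]/(g)` (the second centre on the point-step charts)

Helper for the research stub `stub_elnat_tcDeltaPointResolution` (T-ISO-0⁺) of the crux `EquisingularLiftNat`
(stmt-ResolutionOfSingularities-20038; route `EquisingularLift`, chain w45b; res-D-pv-034 AS res-L1-s36-pv-3 ASK 09:00:33Z
(Q1)/(Q2) for SPECIMEN-Q DOWNSTAIRS, lead-2 CUT 08:41:07Z). NOT a statement of any manuscript; AI-written kernel lemma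
of the cell `res-hironaka` (weaker than expert review).

`A = k[y₀,y₁,y₂]`, `f = y₂² + y₀⁴ + y₁⁴` (`fSing`), `g = y₂² + y₁²(1 + y₀⁴)`, `D = A/(g)`,
`Bᵢ = (A/(f))[𝔪̄₀/ȳᵢ] = blowupAlgebra (𝔪₀·(A/(f))) (ȳᵢ)`.

* **(Q2) `radical_span_mk_X_one`** — in `D`: `√(ȳ₁) = (ȳ₁, ȳ₂) = ((y₁, y₂))·D = (WhitneyCubic.cen)·D` (from part IV
  `radical_span_X_one_g` by pulling back along `A ↠ D`).

(Q1) — the generator tracking `ε(ȳ₁) = x̄ᵢ/1` for the isomorphisms `ε : D ≃+* Bᵢ` of `…NatSpecimenQuarticPointStep` — is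
read off their construction (`quotientKerMapQuotientEquiv_mk`, `mapQuotient_algebraMap`); as a standalone statement it
is elaboration-heavy (`Fin (2+1)` vs `Fin 3` under `algebraMap (A/(f)) Bᵢ`) and is left to the consumer's proof context.
With it and (Q2) the vanishing ideal of the exceptional set `V(x̄ᵢ/1) ⊂ Spec Bᵢ` is `ε((ȳ₁, ȳ₂))`, so the second
blow-up's charts are `blowupAlgebra.congrEquiv ε` of the regular rings `isRegularRing_lineChart₀/₁` (p510354).
-/

set_option linter.dupNamespace false -- mandated namespace `Summit.<Summit>.<Problem>` of this single-conjunct summit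

noncomputable section

open MvPolynomial
open Literature.AlgebraicGeometry.Resolution
open Summit.ResolutionOfSingularities.ResolutionOfSingularities.Cruxes.EquisingularLiftNat.Sections

namespace Summit.ResolutionOfSingularities.ResolutionOfSingularities.Theorems.EquisingularLift.SpecimenQuartic

variable (k : Type) [Field k]

/-! ## (Q2) `√(ȳ₁) = (ȳ₁, ȳ₂)` in `D = k[y]/(g)` -/

/-- **`√(ȳ₁) = (ȳ₁, ȳ₂)` in `D = k[y₀,y₁,y₂]/(g)`**, `g = y₂² + y₁²(1 + y₀⁴)`: the reduced exceptional trace on the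
point-step chart is the extension of the line-step centre `(y₁, y₂) = (WhitneyCubic.cen)`. (Pull back along `A ↠ D`:
both sides have preimage `√(y₁, g) = (y₁, y₂) ∋ g`, part IV.) [OURS · T-ISO-1 algebra] -/
theorem radical_span_mk_X_one :
    (Ideal.span {Ideal.Quotient.mk (Ideal.span {(X 2 ^ 2 + X 1 ^ 2 * (1 + X 0 ^ 4) : MvPolynomial (Fin 3) k)})
        (X 1)}).radical =
      (Ideal.span (Set.range (WhitneyCubic.cen k))).map
        (Ideal.Quotient.mk (Ideal.span {(X 2 ^ 2 + X 1 ^ 2 * (1 + X 0 ^ 4) : MvPolynomial (Fin 3) k)})) := by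
  set q := Ideal.Quotient.mk (Ideal.span {(X 2 ^ 2 + X 1 ^ 2 * (1 + X 0 ^ 4) : MvPolynomial (Fin 3) k)}) with hq
  have hsurj : Function.Surjective q := Ideal.Quotient.mk_surjective
  have hker : Ideal.comap q ⊥ = Ideal.span {(X 2 ^ 2 + X 1 ^ 2 * (1 + X 0 ^ 4) : MvPolynomial (Fin 3) k)} := by
    rw [← RingHom.ker_eq_comap_bot, hq, Ideal.mk_ker]
  have hg_cen : (X 2 ^ 2 + X 1 ^ 2 * (1 + X 0 ^ 4) : MvPolynomial (Fin 3) k) ∈ Ideal.span (Set.range (WhitneyCubic.cen k)) := by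
    rw [span_range_cen_eq_pair]
    have e : (X 2 ^ 2 + X 1 ^ 2 * (1 + X 0 ^ 4) : MvPolynomial (Fin 3) k) =
        X 2 * X 2 + X 1 * (X 1 * (1 + X 0 ^ 4)) := by ring
    rw [e]
    exact Ideal.add_mem _ (Ideal.mul_mem_left _ _ (Ideal.subset_span (by simp)))
      (Ideal.mul_mem_right _ _ (Ideal.subset_span (by simp)))
  apply Ideal.comap_injective_of_surjective q hsurj
  rw [Ideal.comap_radical, Ideal.comap_map_of_surjective q hsurj, hker,
    show Ideal.span {q (X 1)} = (Ideal.span {(X 1 : MvPolynomial (Fin 3) k)}).map q by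
      rw [Ideal.map_span, Set.image_singleton],
    Ideal.comap_map_of_surjective q hsurj, hker]
  -- LHS: `√((y₁) ⊔ (g)) = √(y₁, g) = (y₁, y₂)`; RHS: `(y₁, y₂) ⊔ (g) = (y₁, y₂)`
  have hsup : Ideal.span {(X 1 : MvPolynomial (Fin 3) k)} ⊔
      Ideal.span {(X 2 ^ 2 + X 1 ^ 2 * (1 + X 0 ^ 4) : MvPolynomial (Fin 3) k)} =
      Ideal.span {(X 1 : MvPolynomial (Fin 3) k), X 2 ^ 2 + X 1 ^ 2 * (1 + X 0 ^ 4)} := by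
    rw [← Ideal.span_union, Set.singleton_union]
  rw [hsup, radical_span_X_one_g, sup_eq_left.mpr ((Ideal.span_singleton_le_iff_mem _).mpr hg_cen)]

end Summit.ResolutionOfSingularities.ResolutionOfSingularities.Theorems.EquisingularLift.SpecimenQuartic

end
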